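import Summits.BirchSwinnertonDyer.BirchSwinnertonDyer.Theses.SignedBalanceX9
import Summits.BirchSwinnertonDyer.BirchSwinnertonDyer.Theorems.SignedBalanceX9TwistedAnalyticMuZeroCoprimeX9QuadFieldSplittingBridge
import Summits.BirchSwinnertonDyer.BirchSwinnertonDyer.Theorems.SignedBalanceX9Rung648a1
import Summits.BirchSwinnertonDyer.Rank1Residual.X9.TorsionDepthCoprimeClassNumber
import Literature.NumberTheory.EllipticCurves.HeegnerNormPointExistenceProofs
import HarnessLib

/-!
# BC5 / T3 witness rung BY ID for route `SignedBalanceX9`, UPPER side (item stmt-BirchSwinnertonDyer-26943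
# `FourTermDefectUpperCoprimeX9OfPrint` ⊇ stmt-BirchSwinnertonDyer-25217 `FourTermDefectUpperCoprimeX9`):
# input (1) of the coprime four-term passage — Howard's anticyclotomic containment — AT EVERY COPRIME
# BCS-ADMISSIBLE FRAME, from the route's OWN binder `MastellaZermanHowardDivisibility`, and INSTANCED at
# `(648a1, 5; d_K = -71, d_F = 73)`

HONEST FRAMING (tribunal-w seat `bsd-trib-w-tld` g5 = the bc5-witness planner for routes TLD + SBX9, D-0154 KEY
(146) row 9; cell `run/shared/lean/pub/bsd-print-x9/`; D-0033 T3, `docs/architecture/tribunal.md` §T3). The route's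
tribunal T3 record (operator, 2026-08-28T02:34Z) reads, for the DECIDING upper side `FourTermDefectUpperX9` (now
re-typed at coprime frames as stmt-25217 and, with its print inputs as explicit hypotheses, stmt-26943, binder `hUpP`
of `closes` at rev 10/11): «WITNESS AS FILED: NONE … the per-pair unit-coefficient certificate is a rung for Mu/Tw,
NOT for Up … T3 ABSENT ⇒ PLAN-ONLY OWED: first rung = input (1) TYPED AND INSTANCED — BCK21 Thm 3.1's conclusion
(Howard's Theorem B containment) at ONE X9 pair with an exhibited Heegner field K, p ∤ h_K; first seat = bc5-witness
planner». This file discharges that plan-only debt with theorems, in the route's own currency: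

* `rung_howardContainment_coprimeFrame_tied` (**THE RUNG**): for every X9 pair `(W, p)` and every BCS-admissible
  frame `(d_K, d_F)` whose imaginary quadratic fields have `p ∤ h_K` — the FIRST THREE BINDERS OF stmt-25217
  VERBATIM (`ClassX9 W p → BCSAdmissiblePair W p dK dF → (∀ K, IsImaginaryQuadratic K → discr K = dK → ¬ p ∣ h_K) →`)
  — and every imaginary quadratic `K` with `discr K = d_K`, every anticyclotomic `(κ, γ)`, every modular
  parametrisation datum `Dt`, Heegner datum `H` and complex embedding `ιC`: there are `jbar`, Λ-adic Selmer data `D`,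
  a Heegner family `F` ON `Dt` (`F.Dt = Dt`) and a Selmer dual `X` with `I(ℋ_F)² ≤ char_Λ(X_tors)` — Howard's
  Theorem B containment, i.e. input (1) of the (W)(H)(R)(S)(F) passage of stmt-25217's docstring («at such frames
  Howard's anticyclotomic containment is Mastella–Zerman 2026 Cor 4.6 at p-adic scalar image»). PROOF: from the
  binder `hMZ : MastellaZermanHowardDivisibility` (item stmt-25233 = binder `hMZ` of `closes`, load-bearing) ALONE:
  the frame's splitting clauses give the Heegner hypotheses for `N_E` and for `p` (bridge
  `splitsInQuadField_discr_iff_ncard_primesOver_eq_two`, landed for this route's line `coprime-frame`), `d_K ≠ -3, -4`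
  from admissibility, and then Mastella–Zerman Cor. 4.6 BY NAME at `ClassX9.mz26Hypotheses` with the family ON `Dt`
  by the Literature theorem `exists_heegnerFamily_Dt_eq_holds` (PIN-1 (T4)).
* `rung_howardContainment_coprimeFrame` : the same UNTIED (`∃ jbar D F X, I(ℋ_F)² ≤ char_Λ(X_tors)`), and
  `rung_isSlice_anyClassNumber (hA : HowardContainmentAnyClassNumber)` : the route's any-class-number A-side
  (item stmt-23161, `aside` r201 here, child of `FourTermDefectUpperX9`) specialises to the untied rung — the
  kernel certificate that the rung IS the coprime-admissible-frame slice of crux A BY ID.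
* `rung_howardContainment_648a1_5_neg71` (**THE INSTANCE** the T3 record asks for): the X9 record `648a1`
  (`W = ⟨0,0,0,-3,14⟩`, `N = 648`), `p = 5`, the frame `(d_K, d_F) = (-71, 73)` certified admissible in the kernel
  (`TwinTransportX9Rung.bcsAdmissiblePair_648a1`) with `h(-71) = 7`, `5 ∤ 7` decided in the kernel
  (`SignedBalanceX9Rung.not_five_dvd_classNumber_of_discr_neg71`): for EVERY imaginary quadratic `K` of
  discriminant `-71` (the exhibited Heegner field `ℚ(√-71)`), the tied Howard containment — granting `hMZ` and the
  class predicate `ClassX9 648a1 5` (displayed binder, exactly as in the route's Mu/Tw rung `rung_648a1_5`).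

WHY OUTSIDE S's KNOWN REGIME (T3): `S = Rank1Residual.BSDpOnClassX9` is not a theorem on any X9 pair (small
image: BCS25 Thm. 1.1.2 (b) needs (sur)/(im); kernel `s_case found = false`); the rung is the printed (MZ26 Cor. 4.6,
integral, `p ∤ h_K`) INPUT of the upper inequality, not the inequality: the four-term passage (W)(H)(R)(S)(F) of
stmt-25217 (formalisation XL; bundle v1 = stmt-26942, 3–4 residual facts untyped) is NOT touched, nor are the cruxes
`AnalyticMuZeroX9` (Greenberg μ = 0, open) / `SchneiderX9RankOne`. Nothing here closes an item; no leaf, no `closes`;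
BSD is NOT proved. Companion (lower side, of record): `SignedBalanceX9Rung.rung_648a1_5` (Mu/Tw at the same frame).

DEDUP NOTE: the untied any-frame twin typed over route `TorsionLayerDescent`'s decls is
`TorsionLayerDescentRung.rung_coprimeClassNumber` (p607032; frame stated by Heegner hypotheses on `K`); the statements
here are in stmt-25217's FRAME currency (`BCSAdmissiblePair`, `d_K`) and typed over THIS route's binder, which is what
the kernel's `witness_mentions_crux` reads. No Literature fact is restated; no definition.

References: [MastellaZerman2026] Cor. 4.6, Assumptions 2.1, 2.13 (v) (arXiv:2505.08710); [Howard2004HeegnerKolyvagin]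
Thm. B, §2.7, §3.3; [BertoliniCastellaKim2021 = BCK21] Thm. 3.1; [BurungaleCastellaSkinner2025] §1.2 (Heeg), (splt),
Prop. 5.2.1, Thm. 1.1.2 (b) (arXiv:2405.00270); [Cox2013] Thm. 2.13, Thm. 7.7 (ii); [Marcus1977] Ch. 3 Thm. 25;
[LombardoTronto2022] Thm. 3.16; [GreenbergLNM1716] §1.
-/

set_option autoImplicit false
set_option linter.dupNamespace false

noncomputable section

open scoped Classical

open WeierstrassCurve NumberField Literature Literature.NumberTheory.EllipticCurves
  Literature.NumberTheory.EllipticCurves.ModularForms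
  Summit.BirchSwinnertonDyer.BirchSwinnertonDyer.Rank1Residual
  Summit.BirchSwinnertonDyer.BirchSwinnertonDyer.Theses.SignedBalanceX9

namespace Summit.BirchSwinnertonDyer.BirchSwinnertonDyer.Theorems.SignedBalanceX9HowardRung

/-! ## §1 The frame: BCS-admissibility of `(d_K, d_F)` gives the Heegner hypotheses of every `K` with `discr K = d_K` -/

/-- (Heeg) of a BCS-admissible frame, in ideal-counting currency: every prime of the conductor splits in any
quadratic `K` of discriminant `d_K`. [cite: BurungaleCastellaSkinner2025, §1.2 (Heeg)] [cite: Marcus1977, Ch. 3 Thm. 25] -/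
theorem satisfiesHeegnerHypothesis_conductorNorm_of_bcsAdmissiblePair {W : WeierstrassCurve ℚ} [W.IsElliptic]
    [W.IsGloballyMinimal] {p : ℕ} {dK dF : ℤ} (hadm : BCSAdmissiblePair W p dK dF) {K : Type} [Field K]
    [NumberField K] (hK2 : Module.finrank ℚ K = 2) (hdK : NumberField.discr K = dK) :
    SatisfiesHeegnerHypothesis (W.conductorNorm ℤ) K := by
  intro ℓ hℓ hℓN
  have h1 : SplitsInQuadField (NumberField.discr K) ℓ := by rw [hdK]; exact hadm.2.1 ℓ hℓ hℓN
  exact (splitsInQuadField_discr_iff_ncard_primesOver_eq_two hK2 hℓ).mp h1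

/-- (splt) of a BCS-admissible frame: `p` splits in any quadratic `K` of discriminant `d_K`, as the Heegner
hypothesis for the level `p`. [cite: BurungaleCastellaSkinner2025, §1.2 (splt)] [cite: Marcus1977, Ch. 3 Thm. 25] -/
theorem satisfiesHeegnerHypothesis_prime_of_bcsAdmissiblePair {W : WeierstrassCurve ℚ} [W.IsElliptic]
    [W.IsGloballyMinimal] {p : ℕ} [Fact p.Prime] {dK dF : ℤ} (hadm : BCSAdmissiblePair W p dK dF) {K : Type}
    [Field K] [NumberField K] (hK2 : Module.finrank ℚ K = 2) (hdK : NumberField.discr K = dK) :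
    SatisfiesHeegnerHypothesis p K := by
  intro ℓ hℓ hℓp
  obtain rfl : ℓ = p := (Nat.prime_dvd_prime_iff_eq hℓ (Fact.out : p.Prime)).mp hℓp
  have h1 : SplitsInQuadField (NumberField.discr K) ℓ := by rw [hdK]; exact hadm.2.2.1
  exact (splitsInQuadField_discr_iff_ncard_primesOver_eq_two hK2 hℓ).mp h1

/-- A BCS-admissible `d_K` is neither `-3` (by definition) nor `-4` (`d_K ≡ 1 (mod 4)`).
[cite: BurungaleCastellaSkinner2025, §1.2] -/
theorem discr_ne_of_bcsAdmissiblePair {W : WeierstrassCurve ℚ} [W.IsElliptic] [W.IsGloballyMinimal] {p : ℕ}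
    {dK dF : ℤ} (hadm : BCSAdmissiblePair W p dK dF) {K : Type} [Field K] [NumberField K]
    (hdK : NumberField.discr K = dK) : NumberField.discr K ≠ -3 ∧ NumberField.discr K ≠ -4 := by
  obtain ⟨⟨-, -, h4, h3⟩, -⟩ := hadm
  refine ⟨by rw [hdK]; exact h3, ?_⟩
  rw [hdK]; omega

/-! ## §2 THE RUNG: Howard's containment at every coprime BCS-admissible frame, from the binder `hMZ` alone -/

/-- **THE RUNG (tied) — BC5/T3 witness BY ID for the upper side of route `SignedBalanceX9`.** Binders 1–3 of
stmt-25217 `FourTermDefectUpperCoprimeX9` verbatim, then Howard's Theorem B containment `I(ℋ_F)² ≤ char_Λ(X_tors)`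
for a Heegner family ON the given `Dt`, at every imaginary quadratic `K` of discriminant `d_K` and every
anticyclotomic datum — from `hMZ : MastellaZermanHowardDivisibility` (item stmt-25233, binder of `closes`) alone.
PRINT regime; input (1) of the four-term passage, not the passage; BSD NOT proved.
[cite: MastellaZerman2026, Cor. 4.6, Assumptions 2.1 and 2.13 (v) (arXiv:2505.08710)]
[cite: Howard2004HeegnerKolyvagin, Thm. B, §2.7, §3.3] [cite: BurungaleCastellaSkinner2025, §1.2, Prop. 5.2.1]
[cite: LombardoTronto2022, Thm. 3.16] -/
theorem rung_howardContainment_coprimeFrame_tied (hMZ : MastellaZermanHowardDivisibility) :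
    ∀ (W : WeierstrassCurve ℚ) [W.IsElliptic] [W.IsGloballyMinimal] (p : ℕ) [Fact p.Prime]
      [NeZero (W.conductorNorm ℤ)] (dK dF : ℤ),
      ClassX9 W p → BCSAdmissiblePair W p dK dF →
      (∀ (K : Type) [Field K] [NumberField K], IsImaginaryQuadratic K →
        NumberField.discr K = dK → ¬ p ∣ NumberField.classNumber K) →
      ∀ (K : Type) [Field K] [NumberField K], IsImaginaryQuadratic K → NumberField.discr K = dK →
      ∀ (κ : ZpExtension K p), κ.IsAnticyclotomic → ∀ (γ : Field.absoluteGaloisGroup K),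
      κ.IsTopGenerator γ →
      ∀ (Dt : ModularParametrizationData W (W.conductorNorm ℤ))
        (H : HeegnerDatum (W.conductorNorm ℤ) (NumberField.discr K)) (ιC : K →+* ℂ),
      ∃ (jbar : AlgebraicClosure K →+* ℂ) (D : (W.baseChange K).LambdaAdicSelmerData κ γ)
        (F : HeegnerFamily (W.conductorNorm ℤ) W K κ jbar) (X : (W.baseChange K).SelmerDualData κ γ),
        F.Dt = Dt ∧ heegnerCharIdeal D F ^ 2 ≤
          Module.charIdeal (IwasawaAlgebra p) (Submodule.torsion (IwasawaAlgebra p) X.X) := by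
  intro W _ _ p _ _ dK dF hX9 hadm hcop K _ _ hK hdK κ hκ γ hγ Dt H ιC
  have hHN := satisfiesHeegnerHypothesis_conductorNorm_of_bcsAdmissiblePair hadm hK.1 hdK
  have hHp := satisfiesHeegnerHypothesis_prime_of_bcsAdmissiblePair hadm hK.1 hdK
  have h34 := discr_ne_of_bcsAdmissiblePair hadm hdK
  have hhK : ¬ p ∣ NumberField.classNumber K := hcop K hK hdK
  have hX9' := classX9_census_of_classX9 W p hX9
  -- a complex embedding of `K̄` extending `ιC`
  letI : Algebra K ℂ := ιC.toAlgebra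
  let jbar : AlgebraicClosure K →+* ℂ :=
    (IsAlgClosed.lift (R := K) (M := ℂ) (S := AlgebraicClosure K)).toRingHom
  obtain ⟨D⟩ := LambdaAdicSelmerDataExists.nonempty_lambdaAdicSelmerData (W.baseChange K) p κ hγ
  obtain ⟨X⟩ := (W.baseChange K).nonempty_selmerDualData_holds κ γ hγ
  obtain ⟨F, hFDt, -⟩ := exists_heegnerFamily_Dt_eq_holds hK hHN hX9'.not_dvd_conductorNorm κ Dt
    H.dvd_sq_sub jbar
  -- the binder body (item 25233) IS, definitionally, `MastellaZerman2026.cor46_howardDivisibility_of_scalarImage.{0}`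
  exact ⟨jbar, D, F, X, hFDt, Ideal.le_of_dvd (MastellaZerman2026.conclusion_of_cor46 (jbar := jbar)
    (show MastellaZerman2026.cor46_howardDivisibility_of_scalarImage.{0} from hMZ)
    (hX9'.mz26Hypotheses κ γ hK h34 hHN hHp hhK hκ hγ) D F X)⟩

/-- **The rung, untied** (`∃ jbar D F X, I(ℋ_F)² ≤ char_Λ(X_tors)`), from `hMZ` alone — the shape in which the
any-class-number A-side `HowardContainmentAnyClassNumber` (item stmt-23161) is stated.
[cite: MastellaZerman2026, Cor. 4.6 (arXiv:2505.08710)] [cite: Howard2004HeegnerKolyvagin, Thm. B] -/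
theorem rung_howardContainment_coprimeFrame (hMZ : MastellaZermanHowardDivisibility) :
    ∀ (W : WeierstrassCurve ℚ) [W.IsElliptic] [W.IsGloballyMinimal] (p : ℕ) [Fact p.Prime]
      [NeZero (W.conductorNorm ℤ)] (dK dF : ℤ),
      ClassX9 W p → BCSAdmissiblePair W p dK dF →
      (∀ (K : Type) [Field K] [NumberField K], IsImaginaryQuadratic K →
        NumberField.discr K = dK → ¬ p ∣ NumberField.classNumber K) →
      ∀ (K : Type) [Field K] [NumberField K], IsImaginaryQuadratic K → NumberField.discr K = dK →
      ∀ (κ : ZpExtension K p), κ.IsAnticyclotomic → ∀ (γ : Field.absoluteGaloisGroup K),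
      κ.IsTopGenerator γ →
      ∀ (Dt : ModularParametrizationData W (W.conductorNorm ℤ))
        (H : HeegnerDatum (W.conductorNorm ℤ) (NumberField.discr K)) (ιC : K →+* ℂ),
      ∃ (jbar : AlgebraicClosure K →+* ℂ) (D : (W.baseChange K).LambdaAdicSelmerData κ γ)
        (F : HeegnerFamily (W.conductorNorm ℤ) W K κ jbar) (X : (W.baseChange K).SelmerDualData κ γ),
        heegnerCharIdeal D F ^ 2 ≤
          Module.charIdeal (IwasawaAlgebra p) (Submodule.torsion (IwasawaAlgebra p) X.X) := by
  intro W _ _ p _ _ dK dF hX9 hadm hcop K _ _ hK hdK κ hκ γ hγ Dt H ιC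
  obtain ⟨jbar, D, F, X, -, h⟩ :=
    rung_howardContainment_coprimeFrame_tied hMZ W p dK dF hX9 hadm hcop K hK hdK κ hκ γ hγ Dt H ιC
  exact ⟨jbar, D, F, X, h⟩

/-- **The untied rung IS the coprime-admissible-frame slice of the A-side `HowardContainmentAnyClassNumber`**
(item stmt-BirchSwinnertonDyer-23161, child of the deciding upper item `FourTermDefectUpperX9`; `aside` on this
route since the coprime re-typing, crux of record elsewhere) BY ID: any proof of A reproves the rung, the frame's
admissibility supplying A's Heegner hypotheses and `d_K ≠ -3, -4`, the class-number clause unused.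
[kernel bookkeeping; no mathematical content] [cite: BurungaleCastellaSkinner2025, §1.2] -/
theorem rung_isSlice_anyClassNumber (hA : HowardContainmentAnyClassNumber) :
    ∀ (W : WeierstrassCurve ℚ) [W.IsElliptic] [W.IsGloballyMinimal] (p : ℕ) [Fact p.Prime]
      [NeZero (W.conductorNorm ℤ)] (dK dF : ℤ),
      ClassX9 W p → BCSAdmissiblePair W p dK dF →
      (∀ (K : Type) [Field K] [NumberField K], IsImaginaryQuadratic K →
        NumberField.discr K = dK → ¬ p ∣ NumberField.classNumber K) →
      ∀ (K : Type) [Field K] [NumberField K], IsImaginaryQuadratic K → NumberField.discr K = dK →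
      ∀ (κ : ZpExtension K p), κ.IsAnticyclotomic → ∀ (γ : Field.absoluteGaloisGroup K),
      κ.IsTopGenerator γ →
      ∀ (Dt : ModularParametrizationData W (W.conductorNorm ℤ))
        (H : HeegnerDatum (W.conductorNorm ℤ) (NumberField.discr K)) (ιC : K →+* ℂ),
      ∃ (jbar : AlgebraicClosure K →+* ℂ) (D : (W.baseChange K).LambdaAdicSelmerData κ γ)
        (F : HeegnerFamily (W.conductorNorm ℤ) W K κ jbar) (X : (W.baseChange K).SelmerDualData κ γ),
        heegnerCharIdeal D F ^ 2 ≤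
          Module.charIdeal (IwasawaAlgebra p) (Submodule.torsion (IwasawaAlgebra p) X.X) := by
  intro W _ _ p _ _ dK dF hX9 hadm _ K _ _ hK hdK κ hκ γ hγ Dt H ιC
  have h34 := discr_ne_of_bcsAdmissiblePair hadm hdK
  exact hA W p K hX9 hK h34.1 h34.2 (satisfiesHeegnerHypothesis_conductorNorm_of_bcsAdmissiblePair hadm hK.1 hdK)
    (satisfiesHeegnerHypothesis_prime_of_bcsAdmissiblePair hadm hK.1 hdK) κ hκ γ hγ Dt H ιC

/-! ## §3 THE INSTANCE: the record `648a1` at `p = 5`, frame `(d_K, d_F) = (-71, 73)`, `h(-71) = 7` -/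

/-- **Input (1) INSTANCED (the T3 record's ask): `(648a1, 5)` with the exhibited Heegner field(s) of discriminant
`-71`.** `W = ⟨0,0,0,-3,14⟩` (Cremona `648a1`, `N = 648 = 2³·3⁴`), `p = 5`; `(-71, 73)` is BCS-admissible
(`bcsAdmissiblePair_648a1`, decided in the kernel) and `h(-71) = 7` so `5 ∤ h_K` for EVERY imaginary quadratic `K`
with `discr K = -71` (`not_five_dvd_classNumber_of_discr_neg71`, reduced-forms count decided in the kernel); hence,
granting the binder `hMZ` and the class predicate at the pair (displayed binder, as in the route's Mu/Tw rung
`SignedBalanceX9Rung.rung_648a1_5`), the tied Howard containment at every such `K`. BSD is NOT proved; BSD_p at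
`(648a1, 5)` is NOT asserted. [cite: MastellaZerman2026, Cor. 4.6 (arXiv:2505.08710)]
[cite: Cox2013, §2.A Thm. 2.13, §7.B Thm. 7.7 (ii)] [cite: BurungaleCastellaSkinner2025, §1.2, Prop. 5.2.1] -/
theorem rung_howardContainment_648a1_5_neg71 (hMZ : MastellaZermanHowardDivisibility) :
    haveI := TwinTransportX9Rung.isElliptic_648a1; haveI := TwinTransportX9Rung.isGloballyMinimal_648a1
    haveI : Fact (Nat.Prime 5) := ⟨by norm_num⟩
    ∀ [NeZero ((⟨0, 0, 0, -3, 14⟩ : WeierstrassCurve ℚ).conductorNorm ℤ)],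
      ClassX9 (⟨0, 0, 0, -3, 14⟩ : WeierstrassCurve ℚ) 5 →
      ∀ (K : Type) [Field K] [NumberField K], IsImaginaryQuadratic K → NumberField.discr K = -71 →
      ∀ (κ : ZpExtension K 5), κ.IsAnticyclotomic → ∀ (γ : Field.absoluteGaloisGroup K),
      κ.IsTopGenerator γ →
      ∀ (Dt : ModularParametrizationData (⟨0, 0, 0, -3, 14⟩ : WeierstrassCurve ℚ)
          ((⟨0, 0, 0, -3, 14⟩ : WeierstrassCurve ℚ).conductorNorm ℤ))
        (H : HeegnerDatum ((⟨0, 0, 0, -3, 14⟩ : WeierstrassCurve ℚ).conductorNorm ℤ) (NumberField.discr K))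
        (ιC : K →+* ℂ),
      ∃ (jbar : AlgebraicClosure K →+* ℂ)
        (D : ((⟨0, 0, 0, -3, 14⟩ : WeierstrassCurve ℚ).baseChange K).LambdaAdicSelmerData κ γ)
        (F : HeegnerFamily ((⟨0, 0, 0, -3, 14⟩ : WeierstrassCurve ℚ).conductorNorm ℤ)
          (⟨0, 0, 0, -3, 14⟩ : WeierstrassCurve ℚ) K κ jbar)
        (X : ((⟨0, 0, 0, -3, 14⟩ : WeierstrassCurve ℚ).baseChange K).SelmerDualData κ γ),
        F.Dt = Dt ∧ heegnerCharIdeal D F ^ 2 ≤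
          Module.charIdeal (IwasawaAlgebra 5) (Submodule.torsion (IwasawaAlgebra 5) X.X) := by
  haveI := TwinTransportX9Rung.isElliptic_648a1; haveI := TwinTransportX9Rung.isGloballyMinimal_648a1
  haveI : Fact (Nat.Prime 5) := ⟨by norm_num⟩
  intro _ hX9 K _ _ hK hdK κ hκ γ hγ Dt H ιC
  exact rung_howardContainment_coprimeFrame_tied hMZ (⟨0, 0, 0, -3, 14⟩ : WeierstrassCurve ℚ) 5 (-71) 73 hX9
    TwinTransportX9Rung.bcsAdmissiblePair_648a1 SignedBalanceX9Rung.not_five_dvd_classNumber_of_discr_neg71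
    K hK hdK κ hκ γ hγ Dt H ιC

end Summit.BirchSwinnertonDyer.BirchSwinnertonDyer.Theorems.SignedBalanceX9HowardRung

end
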